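import Summits.ABC.StewartYu.PadicG3HalfSlots
import Summits.ABC.StewartYu.PadicG3OddLamLines
import HarnessLib

/-!
# Cell abc-stewartyu, crux `Y07Odd` (stmt-ABC-19658), line `gen3-slab-odd`: the Kummer HALF-STEP CONJUNCT of `IneqPackR₃` from SLOT CEILINGS —
# the `Λ`-line twin of `hgainH_of_slots` and the assembled conjunct (generic layer over an abstract schedule `Sc`)

`Summits/ABC/StewartYu/PadicG3HalfSlotsLam.lean` — cell `abc-stewartyu` (HOME `run/shared/lean/pub/abc-stewartyu/`), seat p4 (g4); sequel to
`PadicG3HalfSlots` (p506578).  Theorems only; no named fact; no numbers; no schedule instance.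

Per R23 (route holder 2026-08-27T06:21Z) the `‖Λ‖`-branch of the half-step is discharged DIRECTLY (lp-1 g4's `hH_of_lamLines`, `PadicG3OddLamLines`):
besides the gain line it needs the `Λ`-LINE `log BwP + (⌊(t−1)/2⌋ + condExp)·log p + 2^{n+1}·(per-degree threshold cost) − log DCs < E·log p`.  The
per-degree threshold cost is the SAME quantity as in the gain line, so `PadicG3HalfSlots.perDegreeH_le` prices it by the same slots:
* **`hlamH_of_slots`** — the `Λ`-line of `hH_of_lamLines` from the slot ceilings and the per-level budget
  `log BwP + (⌊(tS lev−1)/2⌋ + condExp p (2·NS lev n+1) (tS lev))·log p + 2^{n+1}·(⟨slots⟩) < E·log p`;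
* **`halfConj_of_slots`** — conjunct 3 of `IneqPackR₃ S Sc` (the Kummer half-steps, sharp currency) from `‖Λ/b_{j₀}‖ ≤ (p^E)⁻¹`, the slot
  ceilings, and the two per-level budgets (the `Λ`-budget against `E·log p`, the gain budget against `(2·NS lev n+1)·tS lev·((m+½)·log p)`).

WHAT THIS IS NOT: no budget inequality, no schedule; no crux move.

References: Yu. V. Nesterenko, LNM 1819 (2003) §4.3 (4.39)–(4.45); K. Yu, Acta Math. 211 (2013) (5.35)–(5.39).
-/

noncomputable section

open NormedSpace Finset Polynomial
open Literature.NumberTheory.Transcendental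
open Literature.NumberTheory.Transcendental.PadicCW77 (condExp)
open Literature.NumberTheory.Transcendental.CW77.Setup (Tau tauNorm)
open scoped Nat

namespace Summit.ABC.StewartYu

namespace G3Setup

variable {p : ℕ} [Fact p.Prime] (S : G3Setup p) (Sc : G3Sched S.n)

/-- **THE `Λ`-LINE OF THE KUMMER HALF-STEP FROM SLOT CEILINGS** (every schedule): the `hlam` hypothesis of lp-1's `hH_of_lamLines`, from the
slot ceilings of `hgainH_of_slots` and the per-level `Λ`-budget `hBΛ`. [cite: Nesterenko2003, §4.3 (4.39)–(4.45); shape only] -/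
theorem hlamH_of_slots {W : ℝ} (hWb : ∀ j, Real.log (max 3 (|S.b j| : ℝ)) ≤ W)
    {V : Fin S.n → ℝ} (hV : ∀ j, Height.logHeight₁ (S.α j) ≤ V j)
    {cν cU cA : ℝ} (hν : Real.log (Nat.lcmUpto Sc.H : ℝ) ≤ cν) (hcν : 0 ≤ cν)
    (hcU : Real.log (S.UcardS₂ Sc : ℝ) ≤ cU) (hcA : Real.log (S.AmaxS₂ Sc) ≤ cA)
    {cX cS cL Tq : ℕ → ℝ}
    (hcX : ∀ lev < Sc.Sd, Real.log (max 1 (S.XbC (S.Lb (S.sideS₂ Sc) lev) : ℝ)) ≤ cX lev)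
    (hcS : ∀ lev < Sc.Sd, ∑ j, (S.Lb (S.sideS₂ Sc) lev j : ℝ) * V j ≤ cS lev)
    (hcS0 : ∀ lev < Sc.Sd, 0 ≤ cS lev)
    (hcL : ∀ lev < Sc.Sd, ∀ s₁ : ℤ, |s₁| ≤ (2 * S.NhS Sc (lev + 1) - 1 : ℤ) →
      (Sc.L₀ : ℝ) * (1 + Real.log (1 + |((2 ^ (Sc.Sd - (lev + 1)) * s₁ : ℤ) : ℝ)| / Sc.H)) ≤ cL lev)
    (hTq : ∀ lev < Sc.Sd, ((S.TordS Sc lev S.n : ℕ) : ℝ) - S.tS Sc lev ≤ Tq lev)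
    {E : ℕ}
    (hBΛ : ∀ lev < Sc.Sd,
      Real.log (BwP (p := p) Sc.L₀ Sc.m) +
          ((((S.tS Sc lev - 1) / 2 + condExp p (2 * S.NS Sc lev S.n + 1) (S.tS Sc lev) : ℕ)) : ℝ) * Real.log p +
          (((2 ^ (S.n + 1) : ℕ) : ℝ)) *
          (Real.log 4 + 3 * Real.log 2 + 2 * cU + cA + Sc.H / Real.exp 1 + 3 * ∑ j, V j + cL lev +
            Tq lev * max (3 * cν + ((Sc.Sd - lev : ℕ) : ℝ) * Real.log 2) (2 * W + cX lev) +
            4 * (2 * (S.NhS Sc (lev + 1) : ℝ) - 1) * cS lev) <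
        (E : ℝ) * Real.log p) :
    ∀ lev < Sc.Sd, ∀ s₁ : ℤ, Odd s₁ → |s₁| ≤ (2 * S.NhS Sc (lev + 1) - 1 : ℤ) → ∀ τ : Tau S.n, tauNorm τ + S.tS Sc lev ≤ S.TordS Sc lev S.n →
      Real.log (BwP (p := p) Sc.L₀ Sc.m) +
            ((((S.tS Sc lev - 1) / 2 + condExp p (2 * S.NS Sc lev S.n + 1) (S.tS Sc lev) : ℕ)) : ℝ) * Real.log p +
            (((2 ^ (S.n + 1) : ℕ) : ℝ)) * (Real.log 4 + 2 * Real.log (S.DCs (S.Lb (S.sideS₂ Sc) lev) Sc.H s₁ τ : ℝ) +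
              Real.log (1 + (S.UcardS₂ Sc : ℝ) * (S.PmaxS₂ Sc) * S.MhCs (S.Lb (S.sideS₂ Sc) lev) Sc.L₀ Sc.H Sc.Sd lev s₁ τ) +
              3 * Real.log (CW77.heightProd S.α)) -
          Real.log (S.DCs (S.Lb (S.sideS₂ Sc) lev) Sc.H s₁ τ : ℝ) <
        (E : ℝ) * Real.log p := by
  intro lev hlev s₁ _hs₁ hs₁' τ hτ
  have hper := S.perDegreeH_le Sc hWb hV hν hcU hcA hlev s₁ τ (hcX lev hlev) (hcS lev hlev) (hcL lev hlev s₁ hs₁')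
  have hBl := hBΛ lev hlev
  have hD0 : 0 ≤ Real.log (S.DCs (S.Lb (S.sideS₂ Sc) lev) Sc.H s₁ τ : ℝ) :=
    Real.log_nonneg (by exact_mod_cast S.one_le_DCs _ _ _ _)
  have hτ' : (τ.1 : ℝ) + ((∑ k, τ.2 k : ℕ) : ℝ) ≤ Tq lev := by
    have h1 : ((τ.1 + ∑ k, τ.2 k + S.tS Sc lev : ℕ) : ℝ) ≤ (S.TordS Sc lev S.n : ℕ) := by
      have : tauNorm τ = τ.1 + ∑ k, τ.2 k := rfl
      exact_mod_cast (this ▸ hτ)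
    have h2 := hTq lev hlev
    push_cast at h1 h2 ⊢
    linarith
  have hs : |(s₁ : ℝ)| ≤ 2 * (S.NhS Sc (lev + 1) : ℝ) - 1 := by
    have := hs₁'
    rw [← Int.cast_abs]
    exact_mod_cast this
  have hmax0 : 0 ≤ max (3 * cν + ((Sc.Sd - lev : ℕ) : ℝ) * Real.log 2) (2 * W + cX lev) :=
    le_trans (by positivity) (le_max_left _ _)
  have hm1 : ((τ.1 : ℝ) + ((∑ k, τ.2 k : ℕ) : ℝ)) * max (3 * cν + ((Sc.Sd - lev : ℕ) : ℝ) * Real.log 2) (2 * W + cX lev) ≤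
      Tq lev * max (3 * cν + ((Sc.Sd - lev : ℕ) : ℝ) * Real.log 2) (2 * W + cX lev) :=
    mul_le_mul_of_nonneg_right hτ' hmax0
  have hm2 : 4 * |(s₁ : ℝ)| * cS lev ≤ 4 * (2 * (S.NhS Sc (lev + 1) : ℝ) - 1) * cS lev :=
    mul_le_mul_of_nonneg_right (by linarith) (hcS0 lev hlev)
  have h2n : (0 : ℝ) ≤ ((2 ^ (S.n + 1) : ℕ) : ℝ) := Nat.cast_nonneg _
  have hin : Real.log 4 + 2 * Real.log (S.DCs (S.Lb (S.sideS₂ Sc) lev) Sc.H s₁ τ : ℝ) +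
        Real.log (1 + (S.UcardS₂ Sc : ℝ) * (S.PmaxS₂ Sc) * S.MhCs (S.Lb (S.sideS₂ Sc) lev) Sc.L₀ Sc.H Sc.Sd lev s₁ τ) +
        3 * Real.log (CW77.heightProd S.α) ≤
      Real.log 4 + 3 * Real.log 2 + 2 * cU + cA + Sc.H / Real.exp 1 + 3 * ∑ j, V j + cL lev +
        Tq lev * max (3 * cν + ((Sc.Sd - lev : ℕ) : ℝ) * Real.log 2) (2 * W + cX lev) +
        4 * (2 * (S.NhS Sc (lev + 1) : ℝ) - 1) * cS lev := by linarith
  have hmul := mul_le_mul_of_nonneg_left hin h2n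
  linarith

/-- **THE KUMMER HALF-STEP CONJUNCT OF `IneqPackR₃` FROM SLOT CEILINGS** (every schedule; conjunct 3 verbatim): one smallness exponent
`E` with `‖Λ/b_{j₀}‖ ≤ (p^E)⁻¹`, the slot ceilings, the `Λ`-budget `hBΛ` and the gain budget `hB` per level (lp-1's `hH_of_lamLines` on
`hlamH_of_slots` / `hgainH_of_slots`). [cite: Nesterenko2003, §4.3 (4.39)–(4.45); shape only] -/
theorem halfConj_of_slots {W : ℝ} (hWb : ∀ j, Real.log (max 3 (|S.b j| : ℝ)) ≤ W)
    {V : Fin S.n → ℝ} (hV : ∀ j, Height.logHeight₁ (S.α j) ≤ V j)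
    {cν cU cA : ℝ} (hν : Real.log (Nat.lcmUpto Sc.H : ℝ) ≤ cν) (hcν : 0 ≤ cν)
    (hcU : Real.log (S.UcardS₂ Sc : ℝ) ≤ cU) (hcA : Real.log (S.AmaxS₂ Sc) ≤ cA)
    {cX cS cL Tq : ℕ → ℝ}
    (hcX : ∀ lev < Sc.Sd, Real.log (max 1 (S.XbC (S.Lb (S.sideS₂ Sc) lev) : ℝ)) ≤ cX lev)
    (hcS : ∀ lev < Sc.Sd, ∑ j, (S.Lb (S.sideS₂ Sc) lev j : ℝ) * V j ≤ cS lev)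
    (hcS0 : ∀ lev < Sc.Sd, 0 ≤ cS lev)
    (hcL : ∀ lev < Sc.Sd, ∀ s₁ : ℤ, |s₁| ≤ (2 * S.NhS Sc (lev + 1) - 1 : ℤ) →
      (Sc.L₀ : ℝ) * (1 + Real.log (1 + |((2 ^ (Sc.Sd - (lev + 1)) * s₁ : ℤ) : ℝ)| / Sc.H)) ≤ cL lev)
    (hTq : ∀ lev < Sc.Sd, ((S.TordS Sc lev S.n : ℕ) : ℝ) - S.tS Sc lev ≤ Tq lev)
    {E : ℕ} (hΛ : ‖S.Λ / (S.b S.j₀ : ℚ_[p])‖ ≤ ((p : ℝ) ^ E)⁻¹)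
    (hBΛ : ∀ lev < Sc.Sd,
      Real.log (BwP (p := p) Sc.L₀ Sc.m) +
          ((((S.tS Sc lev - 1) / 2 + condExp p (2 * S.NS Sc lev S.n + 1) (S.tS Sc lev) : ℕ)) : ℝ) * Real.log p +
          (((2 ^ (S.n + 1) : ℕ) : ℝ)) *
          (Real.log 4 + 3 * Real.log 2 + 2 * cU + cA + Sc.H / Real.exp 1 + 3 * ∑ j, V j + cL lev +
            Tq lev * max (3 * cν + ((Sc.Sd - lev : ℕ) : ℝ) * Real.log 2) (2 * W + cX lev) +
            4 * (2 * (S.NhS Sc (lev + 1) : ℝ) - 1) * cS lev) <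
        (E : ℝ) * Real.log p)
    (hB : ∀ lev < Sc.Sd,
      Real.log (BwP (p := p) Sc.L₀ Sc.m) + (((2 ^ (S.n + 1) : ℕ) : ℝ)) *
          (Real.log 4 + 3 * Real.log 2 + 2 * cU + cA + Sc.H / Real.exp 1 + 3 * ∑ j, V j + cL lev +
            Tq lev * max (3 * cν + ((Sc.Sd - lev : ℕ) : ℝ) * Real.log 2) (2 * W + cX lev) +
            4 * (2 * (S.NhS Sc (lev + 1) : ℝ) - 1) * cS lev) <
        (((2 * S.NS Sc lev S.n + 1) * S.tS Sc lev : ℕ) : ℝ) * (((Sc.m : ℝ) + 1 / 2) * Real.log p)) :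
    ∀ lev < Sc.Sd, ∀ s₁ : ℤ, Odd s₁ → |s₁| ≤ (2 * S.NhS Sc (lev + 1) - 1 : ℤ) → ∀ τ : Tau S.n, tauNorm τ + S.tS Sc lev ≤ S.TordS Sc lev S.n →
      max (BwP (p := p) Sc.L₀ Sc.m * ‖S.Λ / (S.b S.j₀ : ℚ_[p])‖ * (p : ℝ) ^ ((S.tS Sc lev - 1) / 2) *
            (p : ℝ) ^ condExp p (2 * S.NS Sc lev S.n + 1) (S.tS Sc lev))
        (BwP (p := p) Sc.L₀ Sc.m / ((p : ℝ) ^ Sc.m * Real.sqrt p) ^ ((2 * S.NS Sc lev S.n + 1) * S.tS Sc lev)) <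
      (S.DCs (S.Lb (S.sideS₂ Sc) lev) Sc.H s₁ τ : ℝ) /
        (4 * (S.DCs (S.Lb (S.sideS₂ Sc) lev) Sc.H s₁ τ : ℝ) ^ 2 *
          (1 + (S.UcardS₂ Sc : ℝ) * (S.PmaxS₂ Sc) * S.MhCs (S.Lb (S.sideS₂ Sc) lev) Sc.L₀ Sc.H Sc.Sd lev s₁ τ) *
          CW77.heightProd S.α ^ 3) ^ (2 ^ (S.n + 1)) :=
  S.hH_of_lamLines Sc hΛ
    (S.hlamH_of_slots Sc hWb hV hν hcν hcU hcA hcX hcS hcS0 hcL hTq hBΛ)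
    (S.hgainH_of_slots Sc hWb hV hν hcν hcU hcA hcX hcS hcS0 hcL hTq hB)

end G3Setup

end Summit.ABC.StewartYu

end
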